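import Literature.Barriers.CriticalPhenomena.GridSAWGadgetsFromDrawnFamily
import HarnessLib

/-!
# Grid-native gadget families: unit-edge named drawings are valid, and Lemma 4 from them

Companion of `GridSAWGadgetsFromDrawnFamily.lean` (the approach-independent end of
Liśkiewicz–Ogihara–Toda 2003, Lemma 4 / `E₀`: `LOT2003_lemma4_gadgets_of_family`). A construction
whose graph `G(ψ)` is a SUBGRAPH OF THE GRID — every vertex a grid point, every edge a unit grid
edge, as for the grid cells of `GridCells.lean` / `CellChain.lean` placed by translation — carries
the identity drawing, and its congestion-freeness is automatic: a point common to two unit edges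
is an end of both, hence a vertex position. This file packages that observation so that such a
construction delivers only names, positions, an abstract edge list and a census:

* `SDrawing.unitOf verts pos E` — the named drawing with every edge `(a, b) ∈ E` drawn as the
  unit path `[pos a, pos b]`;
* **`SDrawing.isValid_unitOf`** — it is valid (`SDrawing.IsValid`, hence numbers to an
  `IsGridDrawing`, `GridSAWStructuredDrawing.lean`) as soon as the names are distinct, `pos` is
  injective on them, every edge joins two listed names at grid-adjacent positions, no edge is
  listed twice (in either orientation), and every name is on at most three edges;
* `SDrawing.exists_edge_unitOf_iff` — the adjacency dictionary of `unitOf` (`(a, b) ∈ E` or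
  `(b, a) ∈ E`);
* **`codeFP_unitOfData`** — the drawing data of `unitOf` in the raw format `ndC` is typed
  polynomial time from typed polynomial-time `verts`, `pos` (on a name, with the instance as
  context), `E`, `s`, `t` (any context code `eσ`);
* **`LOT2003_lemma4_gadgets_of_unitFamily`**, `LOT2003_lemma4_grid_of_unitFamily` — the named
  facts `LOT2003_lemma4_gadgets` and `LOT2003_lemma4_grid` from a grid-native family: lists
  `V ψ`, positions `pos ψ`, unit edges `E ψ`, a graph `G ψ` with that adjacency on `V ψ`, ends
  `s ψ, t ψ ∈ V ψ`, `hamCount (G ψ) (V ψ).toFinset (s ψ) (t ψ) = 2 ^ e ψ * ψ.numSat` with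
  `0 < e ψ`, and `CodeFP` witnesses for `V`, `pos`, `E`, `s`, `t`, `e`.

## References

* M. Liśkiewicz, M. Ogihara, S. Toda, *The complexity of counting self-avoiding walks in
  subgraphs of two-dimensional grids and hypercubes*, TCS 304 (2003) 129–156, §3 (proof of
  Lemma 4) and §4 (proof of Theorem 7: "we … obtain a subgraph of a two-dimensional grid … This
  is `E₀`").
* S. Arora, B. Barak, *Computational Complexity: A Modern Approach*, CUP 2009, §1.3.
-/

namespace Literature.Barriers.CriticalPhenomena.GridSAW

open _root_.Computability
open Literature.Computability.Complexity (CNF FP CodeFP LOT2003_prop2_sharp3SAT_holds)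
open Literature.Computability.Complexity.CodeFP (natE unE bitE pairE rawE listE)
open Literature.Combinatorics.SimpleGraph (hamCount)

/-- Grid-adjacent points are distinct. [folklore] -/
theorem IsGridEdge.ne {p q : GridPoint} (h : IsGridEdge p q) : p ≠ q := by
  rintro rfl
  rcases h with ⟨-, h⟩ | ⟨-, h⟩ <;> simp at h

namespace SDrawing

variable {α : Type*} [DecidableEq α]

/-- **The unit-edge drawing** of an abstract edge list on named grid points: every edge
`(a, b)` is drawn as the unit path `[pos a, pos b]`.
[cite: LiskiewiczOgiharaToda2003, §4 (proof of Theorem 7: a subgraph of the grid as `E₀`)] -/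
def unitOf (verts : List α) (pos : α → GridPoint) (E : List (α × α)) : SDrawing α where
  verts := verts
  pos := pos
  edges := E.map fun e => (e.1, e.2, [pos e.1, pos e.2])

omit [DecidableEq α] in
/-- The vertex list of `unitOf`. [folklore] -/
@[simp] theorem unitOf_verts (verts : List α) (pos : α → GridPoint) (E : List (α × α)) :
    (unitOf verts pos E).verts = verts := rfl

omit [DecidableEq α] in
/-- The positions of `unitOf`. [folklore] -/
@[simp] theorem unitOf_pos (verts : List α) (pos : α → GridPoint) (E : List (α × α)) :
    (unitOf verts pos E).pos = pos := rfl

omit [DecidableEq α] in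
/-- The drawn edges of `unitOf`. [folklore] -/
theorem unitOf_edges (verts : List α) (pos : α → GridPoint) (E : List (α × α)) :
    (unitOf verts pos E).edges = E.map fun e => (e.1, e.2, [pos e.1, pos e.2]) := rfl

omit [DecidableEq α] in
/-- **Adjacency dictionary of the unit-edge drawing**: a drawn edge joins `a` and `b` iff
`(a, b)` or `(b, a)` is listed. [folklore] -/
theorem exists_edge_unitOf_iff (verts : List α) (pos : α → GridPoint) (E : List (α × α)) (a b : α) :
    (∃ d ∈ (unitOf verts pos E).edges, (d.1 = a ∧ d.2.1 = b) ∨ (d.1 = b ∧ d.2.1 = a)) ↔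
      (a, b) ∈ E ∨ (b, a) ∈ E := by
  simp only [unitOf_edges, List.mem_map, exists_exists_and_eq_and]
  constructor
  · rintro ⟨e, he, ⟨rfl, rfl⟩ | ⟨rfl, rfl⟩⟩
    · exact Or.inl he
    · exact Or.inr he
  · rintro (h | h)
    · exact ⟨_, h, Or.inl ⟨rfl, rfl⟩⟩
    · exact ⟨_, h, Or.inr ⟨rfl, rfl⟩⟩

/-- The degree in the unit-edge drawing is the number of listed edges at the vertex. [folklore] -/
theorem degree_unitOf (verts : List α) (pos : α → GridPoint) (E : List (α × α)) (a : α) :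
    (unitOf verts pos E).degree a = E.countP fun e => decide (e.1 = a ∨ e.2 = a) := by
  rw [degree, unitOf_edges, List.countP_map]
  exact List.countP_congr fun e _ => by simp

/-- **Unit-edge drawings are valid**: distinct names at distinct points, edges between listed
names at grid-adjacent points, no repeated edge, at most three edges at a name — then
`unitOf verts pos E` is a valid named grid drawing (congestion-freeness is automatic: the only
points of a unit path are its two ends). [cite: LiskiewiczOgiharaToda2003, §4 (proof of Theorem 7, E₀)] -/
theorem isValid_unitOf {verts : List α} {pos : α → GridPoint} {E : List (α × α)}
    (hnd : verts.Nodup) (hinj : ∀ a ∈ verts, ∀ b ∈ verts, pos a = pos b → a = b)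
    (hE : ∀ e ∈ E, e.1 ∈ verts ∧ e.2 ∈ verts ∧ IsGridEdge (pos e.1) (pos e.2))
    (hsimple : E.Pairwise fun e e' => ¬ ((e.1 = e'.1 ∧ e.2 = e'.2) ∨ (e.1 = e'.2 ∧ e.2 = e'.1)))
    (hdeg : ∀ a ∈ verts, (E.countP fun e => decide (e.1 = a ∨ e.2 = a)) ≤ 3) :
    (unitOf verts pos E).IsValid := by
  have hmem : ∀ d ∈ (unitOf verts pos E).edges, ∃ e ∈ E, (e.1, e.2, [pos e.1, pos e.2]) = d :=
    fun d hd => List.mem_map.1 hd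
  refine ⟨hnd, hinj, ?_, ?_, ?_, ?_, ?_, ?_, ?_, ?_, ?_, ?_, ?_⟩
  · intro d hd; obtain ⟨e, he, rfl⟩ := hmem d hd; exact (hE e he).1
  · intro d hd; obtain ⟨e, he, rfl⟩ := hmem d hd; exact (hE e he).2.1
  · intro d hd; obtain ⟨e, he, rfl⟩ := hmem d hd
    intro h
    exact (hE e he).2.2.ne (by simp only at h; rw [h])
  · intro d hd; obtain ⟨e, he, rfl⟩ := hmem d hd; rfl
  · intro d hd; obtain ⟨e, he, rfl⟩ := hmem d hd; rfl
  · intro d hd; obtain ⟨e, he, rfl⟩ := hmem d hd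
    simp [(hE e he).2.2.ne]
  · intro d hd; obtain ⟨e, he, rfl⟩ := hmem d hd
    simpa using (hE e he).2.2
  · intro d hd v hv hpv; obtain ⟨e, he, rfl⟩ := hmem d hd
    simp only [List.mem_cons, List.not_mem_nil, or_false] at hpv
    rcases hpv with h | h
    · exact Or.inl (hinj v hv e.1 (hE e he).1 h)
    · exact Or.inr (hinj v hv e.2 (hE e he).2.1 h)
  · rw [unitOf_edges, List.pairwise_map]
    exact hsimple.imp fun {e e'} h hsame => h (by simpa [SameEndsS] using hsame)
  · rw [unitOf_edges, List.pairwise_map]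
    refine List.Pairwise.imp_of_mem (R := fun _ _ => True) ?_ (List.pairwise_of_forall fun _ _ => trivial)
    intro e e' he _ _ p hp _
    simp only [List.mem_cons, List.not_mem_nil, or_false] at hp
    rcases hp with rfl | rfl
    · exact ⟨e.1, (hE e he).1, rfl⟩
    · exact ⟨e.2, (hE e he).2.1, rfl⟩
  · intro a ha
    rw [degree_unitOf]
    exact hdeg a ha

end SDrawing

/-! ### The drawing data of a unit-edge family is typed polynomial time -/

section fp

open Literature.Computability.Complexity.CodeFP

variable {σ : Type} {eσ : σ → List Bool}

/-- **The raw drawing data of `unitOf`** — `(verts, verts.map pos, edges, s, t)` in the format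
`ndC` of `GridSAWGadgetsFromDrawnFamily.lean` — is typed polynomial time in a context `c : σ`
from typed polynomial-time `verts`, `pos` (on a name, with the context), `E`, `s` and `t`.
[cite: AroraBarakCC2009, §1.3] -/
theorem codeFP_unitOfData {V : σ → List ℕ} {pos : σ → ℕ → GridPoint} {E : σ → List (ℕ × ℕ)}
    {s t : σ → ℕ} (hV : CodeFP eσ (rawE natE) V) (hpos : CodeFP (pairE eσ natE) gpC fun q => pos q.1 q.2)
    (hE : CodeFP eσ (rawE (pairE natE natE)) E) (hs : CodeFP eσ natE s) (ht : CodeFP eσ natE t) :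
    CodeFP eσ ndC fun c =>
      ((SDrawing.unitOf (V c) (pos c) (E c)).verts, (V c).map (pos c),
        (SDrawing.unitOf (V c) (pos c) (E c)).edges, s c, t c) := by
  have hP : CodeFP eσ (rawE gpC) fun c => (V c).map (pos c) :=
    ((map hpos).comp ((CodeFP.id eσ).pair hV) :).congr fun _ => rfl
  have hπ₁ : CodeFP (pairE eσ (pairE natE natE)) (pairE eσ natE) fun q => (q.1, q.2.1) :=
    (fst _ _).pair (snd _ _).fst'
  have hπ₂ : CodeFP (pairE eσ (pairE natE natE)) (pairE eσ natE) fun q => (q.1, q.2.2) :=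
    (fst _ _).pair (snd _ _).snd'
  have h1 : CodeFP (pairE eσ (pairE natE natE)) gpC fun q => pos q.1 q.2.1 := (hpos.comp hπ₁ :)
  have h2 : CodeFP (pairE eσ (pairE natE natE)) gpC fun q => pos q.1 q.2.2 := (hpos.comp hπ₂ :)
  have hpath : CodeFP (pairE eσ (pairE natE natE)) (rawE gpC) fun q => [pos q.1 q.2.1, pos q.1 q.2.2] :=
    ((rawCons gpC).comp (h1.pair ((rawSingleton gpC).comp h2 :)) :)
  have hedge : CodeFP (pairE eσ (pairE natE natE)) sedgeC
      fun q => (q.2.1, q.2.2, [pos q.1 q.2.1, pos q.1 q.2.2]) :=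
    (snd _ _).fst'.pair ((snd _ _).snd'.pair hpath)
  have hEdges : CodeFP eσ (rawE sedgeC) fun c => (SDrawing.unitOf (V c) (pos c) (E c)).edges :=
    ((map hedge).comp ((CodeFP.id eσ).pair hE) :).congr fun _ => rfl
  exact (hV.pair (hP.pair (hEdges.pair (hs.pair ht))) :).congr fun _ => rfl

/-- Contiguous names `0, …, n - 1` as the vertex list, from `n` in unary (a grid-native
construction numbering its vertices consecutively hands over `List.range n`). [cite: AroraBarakCC2009, §1.3] -/
theorem codeFP_rangeVerts {n : σ → ℕ} (hn : CodeFP eσ unE n) : CodeFP eσ (rawE natE) fun c => List.range (n c) :=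
  (urange.comp hn :)

end fp

/-! ### Lemma 4 from a grid-native family -/

/-- **Lemma 4's gadget step from a grid-native gadget family.** For every CNF `ψ` let names
`V ψ`, grid positions `pos ψ`, unit edges `E ψ`, a graph `G ψ`, ends `s ψ`, `t ψ` and an exponent
`e ψ` be given such that, for `ψ` in the normal form of Lemma 3: the names are distinct and at
distinct points, every listed edge joins two names at grid-adjacent points, no edge is repeated,
every name is on at most three edges (a subgraph of the grid of maximum degree three), `G ψ` has
exactly this adjacency on `V ψ`, `s ψ, t ψ ∈ V ψ`, `0 < e ψ`, and
`#HamPath(G ψ, s ψ, t ψ) = 2^{e ψ} · #SAT(ψ)`; and such that `V`, `pos`, `E`, `s`, `t`, `e` are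
typed polynomial time on CNF codes. Then `LOT2003_lemma4_gadgets` holds.
[cite: LiskiewiczOgiharaToda2003, §3 (proof of Lemma 4) and §4 (proof of Theorem 7, E₀)] -/
theorem LOT2003_lemma4_gadgets_of_unitFamily (V : CNF ℕ → List ℕ) (pos : CNF ℕ → ℕ → GridPoint)
    (E : CNF ℕ → List (ℕ × ℕ)) (G : CNF ℕ → _root_.SimpleGraph ℕ) (s t e : CNF ℕ → ℕ)
    (hnd : ∀ ψ : CNF ℕ, ψ.IsLOTNormalForm → (V ψ).Nodup)
    (hinj : ∀ ψ : CNF ℕ, ψ.IsLOTNormalForm → ∀ a ∈ V ψ, ∀ b ∈ V ψ, pos ψ a = pos ψ b → a = b)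
    (hE : ∀ ψ : CNF ℕ, ψ.IsLOTNormalForm →
      ∀ d ∈ E ψ, d.1 ∈ V ψ ∧ d.2 ∈ V ψ ∧ IsGridEdge (pos ψ d.1) (pos ψ d.2))
    (hsimple : ∀ ψ : CNF ℕ, ψ.IsLOTNormalForm →
      (E ψ).Pairwise fun d d' => ¬ ((d.1 = d'.1 ∧ d.2 = d'.2) ∨ (d.1 = d'.2 ∧ d.2 = d'.1)))
    (hdeg : ∀ ψ : CNF ℕ, ψ.IsLOTNormalForm →
      ∀ a ∈ V ψ, ((E ψ).countP fun d => decide (d.1 = a ∨ d.2 = a)) ≤ 3)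
    (hadj : ∀ ψ : CNF ℕ, ψ.IsLOTNormalForm → ∀ a ∈ V ψ, ∀ b ∈ V ψ,
      (G ψ).Adj a b ↔ (a, b) ∈ E ψ ∨ (b, a) ∈ E ψ)
    (hs : ∀ ψ : CNF ℕ, ψ.IsLOTNormalForm → s ψ ∈ V ψ)
    (ht : ∀ ψ : CNF ℕ, ψ.IsLOTNormalForm → t ψ ∈ V ψ)
    (he : ∀ ψ : CNF ℕ, ψ.IsLOTNormalForm → 0 < e ψ)
    (hcount : ∀ ψ : CNF ℕ, ψ.IsLOTNormalForm →
      hamCount (G ψ) (V ψ).toFinset (s ψ) (t ψ) = 2 ^ e ψ * ψ.numSat)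
    (hVFP : CodeFP cnfC (rawE natE) V) (hposFP : CodeFP (pairE cnfC natE) gpC fun q => pos q.1 q.2)
    (hEFP : CodeFP cnfC (rawE (pairE natE natE)) E) (hsFP : CodeFP cnfC natE s)
    (htFP : CodeFP cnfC natE t) (heFP : CodeFP cnfC natE e) :
    LOT2003_lemma4_gadgets :=
  LOT2003_lemma4_gadgets_of_family (fun ψ => SDrawing.unitOf (V ψ) (pos ψ) (E ψ)) G s t e
    (fun ψ hψ => SDrawing.isValid_unitOf (hnd ψ hψ) (hinj ψ hψ) (hE ψ hψ) (hsimple ψ hψ) (hdeg ψ hψ))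
    (fun ψ hψ a ha b hb => (hadj ψ hψ a ha b hb).trans (SDrawing.exists_edge_unitOf_iff _ _ _ a b).symm)
    hs ht he hcount (codeFP_unitOfData hVFP hposFP hEFP hsFP htFP) heFP

/-- `LOT2003_lemma4_grid` from a grid-native gadget family (Proposition 2, Lemma 3, Proposition 1).
[cite: LiskiewiczOgiharaToda2003, Proposition 1, Proposition 2, Lemma 3, Lemma 4 and §4 (E₀)] -/
theorem LOT2003_lemma4_grid_of_unitFamily (V : CNF ℕ → List ℕ) (pos : CNF ℕ → ℕ → GridPoint)
    (E : CNF ℕ → List (ℕ × ℕ)) (G : CNF ℕ → _root_.SimpleGraph ℕ) (s t e : CNF ℕ → ℕ)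
    (hnd : ∀ ψ : CNF ℕ, ψ.IsLOTNormalForm → (V ψ).Nodup)
    (hinj : ∀ ψ : CNF ℕ, ψ.IsLOTNormalForm → ∀ a ∈ V ψ, ∀ b ∈ V ψ, pos ψ a = pos ψ b → a = b)
    (hE : ∀ ψ : CNF ℕ, ψ.IsLOTNormalForm →
      ∀ d ∈ E ψ, d.1 ∈ V ψ ∧ d.2 ∈ V ψ ∧ IsGridEdge (pos ψ d.1) (pos ψ d.2))
    (hsimple : ∀ ψ : CNF ℕ, ψ.IsLOTNormalForm →
      (E ψ).Pairwise fun d d' => ¬ ((d.1 = d'.1 ∧ d.2 = d'.2) ∨ (d.1 = d'.2 ∧ d.2 = d'.1)))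
    (hdeg : ∀ ψ : CNF ℕ, ψ.IsLOTNormalForm →
      ∀ a ∈ V ψ, ((E ψ).countP fun d => decide (d.1 = a ∨ d.2 = a)) ≤ 3)
    (hadj : ∀ ψ : CNF ℕ, ψ.IsLOTNormalForm → ∀ a ∈ V ψ, ∀ b ∈ V ψ,
      (G ψ).Adj a b ↔ (a, b) ∈ E ψ ∨ (b, a) ∈ E ψ)
    (hs : ∀ ψ : CNF ℕ, ψ.IsLOTNormalForm → s ψ ∈ V ψ)
    (ht : ∀ ψ : CNF ℕ, ψ.IsLOTNormalForm → t ψ ∈ V ψ)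
    (he : ∀ ψ : CNF ℕ, ψ.IsLOTNormalForm → 0 < e ψ)
    (hcount : ∀ ψ : CNF ℕ, ψ.IsLOTNormalForm →
      hamCount (G ψ) (V ψ).toFinset (s ψ) (t ψ) = 2 ^ e ψ * ψ.numSat)
    (hVFP : CodeFP cnfC (rawE natE) V) (hposFP : CodeFP (pairE cnfC natE) gpC fun q => pos q.1 q.2)
    (hEFP : CodeFP cnfC (rawE (pairE natE natE)) E) (hsFP : CodeFP cnfC natE s)
    (htFP : CodeFP cnfC natE t) (heFP : CodeFP cnfC natE e) :
    LOT2003_lemma4_grid :=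
  LOT2003_lemma4_grid_of_gadgets LOT2003_prop2_sharp3SAT_holds
    (LOT2003_lemma4_gadgets_of_unitFamily V pos E G s t e hnd hinj hE hsimple hdeg hadj hs ht he hcount
      hVFP hposFP hEFP hsFP htFP heFP)

end Literature.Barriers.CriticalPhenomena.GridSAW
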